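import Summits.QuantumAdvantage.QuantumAdvantage.Theses.WhiteBoxWalk
import Literature.Computability.QuantumComplexity.BPPRelSubsetBQPRel
import Literature.Computability.Complexity.RandomizedProofs
import Literature.Computability.Complexity.CountingHierarchyProofs
import Literature.Computability.Cryptography.ShorDiscreteLogTheorem
import Literature.Computability.Complexity.PolyTimeCountable
import Mathlib.Analysis.SpecificLimits.Normed
import Literature.Computability.QuantumComplexity.ReversibleCliffordT

/-!
# Disproof of `WbwThesis` — standing-disprover work file (crux `stmt-QuantumAdvantage-2238`, route `WhiteBoxWalk`)

`WbwThesis` (X, "planted unique-answer white-box quantum advantage"):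
`∃ gen ans, gen ∈ FP ∧ (∃ p, ∀ s, |ans s| = p(|gen s|)) ∧ (Q) ∧ (C)` with
(Q) ONE poly-time-uniform oracle-free Clifford+T family outputs `ans s` (as a prefix of the measured
wires) with probability `≥ 2/3` on input `gen s`, for EVERY seed `s`;
(C) every PPT `A`, given `⟨1ⁿ, gen s⟩` for uniform `s ∈ {0,1}ⁿ`, outputs (a string with prefix) `ans s`
with probability decaying superpolynomially in `n`.

## Findings (cycle 1, `refuter-cdisprove-stmt-QuantumAdvantage-2238-0`, 2026-08-16) — every theorem is `sorry`-free

* §0 READ-BACK. `W.lean` rc 0; `wbwThesis_iff` (`Iff.rfl`) splits X into `ClauseQ`/`ClauseC`.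
  No junk: `2/3 : ℝ`; `kernelProb`, `RandAlg.pr`, `uniformAvg` are genuine probabilities in `[0,1]`;
  `IsPPT` = Mathlib-TM2 polynomial time of `(x,r) ↦ A.run x r` on `boolPair x r` + polynomial coin
  budget (inhabited: `guess_isPPT`, `RandAlg.IsPolyTime.ofDet_holds`); `IsUniform` = TM2 poly-time
  `1ⁿ ↦ sigmaEncode ⟨n, anc n, circ n⟩` (forces poly size). Quantifier order `∃ gen ans F ∀ A` as in
  the informal text. ONE deliberate weakening w.r.t. the word "planted": `ans` is NOT required to be
  poly-time in the seed (only `|ans s| = p(|gen s|)`); immaterial for the route (the glue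
  `WbwSearchToPromise` is proved in the tree without it) and it only makes X harder to refute.
* §1 WHY NO UNCONDITIONAL KILL (and no unconditional proof) CAN BE EXPECTED.
  (i) X is TRUE under a standard assumption: the tree proves Shor's discrete-log theorem
  UNCONDITIONALLY in exactly the model of clause (Q) (`isQSolvable_dlog_holds`, recorded below as
  `dlog_clauseQ_shape`); so any FP generator `s ↦ ⟨p, g, g^a⟩` of DLOG instances that is hard on average
  for PPT witnesses X with `ans s = encodeNat a` — a Lean proof of `¬ X` would therefore contain a PPT
  algorithm computing discrete logarithms on a `1/poly` fraction of every FP-samplable instance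
  distribution, for infinitely many `n`. (ii) Conversely X ⇒ `PromiseBQP ⊄ PromiseBPP'` (tree theorem
  `WhiteBoxWalk.wbwSearchToPromise`-file) ⇒ `P ≠ PSPACE`; and the PLANTED form of X (answers in FP)
  makes `gen` itself a one-way function (§4, `isOneWay_gen_of_planted`). VERDICT: resists; the crux is
  a cryptographic-strength hypothesis, correctly typed.
* §2 LOAD-BEARING `IsPPT` (`clauseC_false_forall_randAlg`, `wbwThesis_false_without_PPT`): with the
  PPT restriction dropped, clause (C) fails for EVERY pair satisfying (Q): the table adversary
  `z = ⟨1^{|s'|}, gen s'⟩ ↦ ans s'` is well defined BECAUSE (Q) makes answers a function of instances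
  (`ans_eq_of_gen_eq`, tree) and wins with probability 1. So (C) is purely computational: every proof
  of X is a proof of a super-polynomial classical lower bound.
* §3 GUESSING BOUND (`answerLength_decay_of_clauseC`): the coin-echo adversary `⟨z, r⟩ ↦ r` is PPT and
  succeeds with probability exactly `2^{-|ans s|}` (`guess_pr`), so any witness has
  `E_{s ∈ {0,1}ⁿ}[2^{-|ans s|}]` negligible. Refuted natural variants: answers of bounded length —
  the "decision-type" thesis `WbwThesisBoundedAnswers` is FALSE (`not_wbwThesisBoundedAnswers`; one
  answer bit is guessed with probability 1/2), and `O(log n)`-bit answers on all seeds of infinitely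
  many lengths kill (C) (`clauseC_false_of_log_answers`). X is irreducibly a SEARCH statement; this is
  why the route needs the bitwise promise problems of `WbwSearchToPromise` rather than a language.
  (The tree's `TypedTraps` already kills answers CONSTANT on all seeds of infinitely many lengths.)
* §4 PLANTED ⇒ ONE-WAY (`isOneWay_gen_of_planted`, `exists_isOneWay_of_wbwThesisPlanted`): if moreover
  `ans ∈ FP` (the intended glued-trees witness: `ans s = name_k(EXIT)` is computed from the seed), then
  (Q)+(C) make `gen` a strong one-way function (an inverter composed with `ans` solves the search, by
  `ans_eq_of_gen_eq`). Hence the planted thesis ⇒ OWF ⇒ `NP ⊄ BPP`: only conditional proofs exist, and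
  the generator of crux `WbwObfuscatedGluedTrees` must in particular be one-way ON ITS OWN (the
  obfuscated circuit + entrance name must not reveal the seed) — a necessary condition checkable
  independently of iO security.
* §5/§7 LOAD-BEARING (Q) — FORMALLY (`wbwThesisWithoutQ_holds`, sorry-free): with clause (Q)
  DROPPED the statement `∃ gen ∈ FP, ans, |ans s| = p(|gen s|) ∧ (C)` is a THEOREM: `gen = id`,
  `ans s = bad |s|`, where `bad n ∈ {0,1}ⁿ` is chosen by averaging (`exists_good_answer`: against
  `< 2ⁿε` (run map, coin count) pairs some answer keeps every success `< ε`, because the prefix events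
  of distinct equal-length answers are disjoint, `sum_succ_le_one`) against the first `n` PPT run maps
  (`runEnum`, from the tree's `countable_setOf_polyTimeComputable`) with all coin counts `< 2^{⌊n/2⌋}`;
  a PPT `A = (ρᵢ, coinLen ≤ p)` is in the level-`n` family for large `n` (`eventually_coinBudget_lt`),
  so its success is `< εₙ = (n·2^{⌊n/2⌋}+1)/2ⁿ`, negligible (`eps_superpolynomialDecay`). HENCE (Q) IS
  THE ENTIRE CONTENT OF X: classical average-case hardness of unique poly-length answers is free; any
  mutant whose quantum clause does not pin `ans` down is trivial. (§7 is stated for any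
  length-preserving instance map `gen`: `clauseC_diagAns`.)
* §8 LOAD-BEARING UNIFORMITY — FORMALLY (`wbwThesis_without_uniform_holds`, sorry-free): with
  `F.IsUniform` DROPPED (everything else kept: `gen ∈ FP`, polynomial length, an ORACLE-FREE Clifford+T
  family succeeding on EVERY seed, and (C)) the statement is again a THEOREM: `gen₀ s = 0^{|s|}`
  (`zerosGen_polyTime`, a finite-state transducer), `ans = diagAns gen₀` (§7), and the NON-UNIFORM
  hard-wired family `hardwiredFamily (bad gen₀)` = compiled `X = HSSH` words (tree:
  `revCompile_mulVec_basisState`) flipping the zeroed input wires where `bad gen₀ n` is `1` — it outputs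
  `ans s` with probability ONE (`hardwiredFamily_kernelProb`, via `kernelProb_eq_one_of_runOn_basisState`).
  So the single UNIFORM family is exactly as load-bearing as (Q): X is "uniform quantum beats uniform
  classical on a samplable unique-answer problem", nothing less, and every conjunct is now accounted
  for (drop IsPPT: false §2; drop (Q): true §7; drop uniformity: true §8; bound the answers: false §3).
* §6 SURPLUS STRENGTH (`clauseCwc_of_clauseC`): (C) ⇒ the WORST-CASE clause `ClauseCwc` (no PPT wins
  with probability `≥ 2/3` on every instance), and the route's glue `WbwSearchToPromise` uses no more than
  `ClauseCwc`. "Hypothesis possibly unnecessary": the planner may weaken X to `FP ∧ length ∧ (Q) ∧ ClauseCwc`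
  (a samplable-promise form of `PromiseBQP ⊄ PromiseBPP`) without touching `closes`; the average-case
  surplus is what pushes X up to OWF strength (§4).
* Literature sweep: searchd / lit unreachable this cycle (rc 75, connection reset) — search-degraded; no
  printed negative result is expected (an unconditional `¬ X` would refute average-case DLOG, §1).
* LANDED (proposals): see NOTES.md / HANDOFF (`Theorems/WbwThesis/Negative/LoadBearing.lean` §0–2,6
  ACCEPTED p83111; `…/GuessingBound.lean` §3–4; `…/Diagonal.lean` §7; `…/NonUniform.lean` §8 — chained
  imports, filed in that order).
-/

set_option linter.dupNamespace false

namespace Summit.QuantumAdvantage.QuantumAdvantage.Cruxes.WbwThesis.Disproof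

open Literature.Computability.Cryptography Literature.Computability.Complexity
open Literature.Computability.QuantumComplexity (kernelProb_add_kernelProb_le_one)
open _root_.Computability Filter Asymptotics

/-! ## §0 Read-back: the two clauses -/

/-- Clause (Q) of `WbwThesis` for a fixed pair `(gen, ans)`: ONE uniform oracle-free Clifford+T family
outputs `ans s` (prefix of the measured wires) with probability `≥ 2/3` on input `gen s`, every `s`.
Verbatim sub-formula of the route decl. [folklore] -/
def ClauseQ (gen ans : List Bool → List Bool) : Prop :=
  ∃ F : QCircuitFamily cliffordT, F.IsOracleFree ∧ F.IsUniform ∧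
    ∀ s, 2 / 3 ≤ F.kernelProb 0 (gen s) {y | ans s <+: y}

/-- Clause (C) of `WbwThesis` for a fixed pair `(gen, ans)` (same body as
`WbwObfuscatedGluedTrees.Negative.ClauseC`; restated to keep this file's imports light). [folklore] -/
def ClauseC (gen ans : List Bool → List Bool) : Prop :=
  ∀ A : RandAlg (List Bool) (List Bool), IsPPT A id →
    SuperpolynomialDecay atTop (fun n : ℕ => (n : ℝ)) (fun n : ℕ =>
      uniformAvg n fun s => A.pr id (boolPair (unaryEncodeNat n) (gen s)) {y | ans s <+: y})

/-- READ-BACK: `WbwThesis ↔ ∃ gen ans, gen ∈ FP ∧ (∃ p, |ans s| = p(|gen s|)) ∧ ClauseQ ∧ ClauseC`,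
definitionally. [folklore] -/
theorem wbwThesis_iff :
    Summit.QuantumAdvantage.QuantumAdvantage.Theses.WhiteBoxWalk.WbwThesis ↔
      ∃ (gen ans : List Bool → List Bool), PolyTimeComputable id id gen ∧
        (∃ p : Polynomial ℕ, ∀ s, (ans s).length = p.eval (gen s).length) ∧
        ClauseQ gen ans ∧ ClauseC gen ans :=
  Iff.rfl

/-- **(Q) makes the answer a function of the instance** (twin of the tree's
`Theorems.WhiteBoxWalk.ans_eq_of_gen_eq`, whose module is not yet built on the farm; same proof):
two distinct equal-length prefixes are disjoint events of probability `≥ 2/3` each. [folklore] -/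
theorem ans_eq_of_gen_eq {gen ans : List Bool → List Bool} {p : Polynomial ℕ}
    (hp : ∀ s, (ans s).length = p.eval (gen s).length) {F : QCircuitFamily cliffordT}
    (hQ : ∀ s, 2 / 3 ≤ F.kernelProb 0 (gen s) {y | ans s <+: y}) {s s' : List Bool}
    (h : gen s = gen s') : ans s = ans s' := by
  by_contra hne
  have hlen : (ans s).length = (ans s').length := by rw [hp, hp, h]
  have hdisj : Disjoint {y : List Bool | ans s <+: y} {y | ans s' <+: y} := by
    refine Set.disjoint_left.2 fun y h1 h2 => hne ?_
    exact (List.prefix_of_prefix_length_le h1 h2 hlen.le).eq_of_length hlen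
  have h1 := hQ s
  have h2 := hQ s'
  rw [← h] at h2
  have := kernelProb_add_kernelProb_le_one F 0 (gen s) hdisj
  linarith

/-- A sequence that is `≥ c > 0` infinitely often does not decay superpolynomially (twin of the
tree's `WbwObfuscatedGluedTrees.Negative.not_superpolynomialDecay_of_frequently_le`). [folklore] -/
theorem not_superpolynomialDecay_of_frequently_le {f : ℕ → ℝ} {c : ℝ} (hc : 0 < c)
    (h : ∃ᶠ n in atTop, c ≤ f n) : ¬ SuperpolynomialDecay atTop (fun n : ℕ => (n : ℝ)) f := by
  intro hdec
  have htend : Tendsto f atTop (nhds 0) := by simpa using hdec 0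
  have hev : ∀ᶠ n : ℕ in atTop, f n < c := htend.eventually (gt_mem_nhds hc)
  obtain ⟨n, hn, hlt⟩ := (h.and_eventually hev).exists
  exact absurd hlt (not_lt.2 hn)

/-! ## §1 Why no unconditional kill: Shor's DLOG theorem has the shape of clause (Q) -/

/-- **The quantum clause is unconditionally available for discrete logarithms** (tree theorem
`isQSolvable_dlog_holds`, Shor 1997 §6 / Kitaev 1995): some uniform oracle-free Clifford+T family
outputs, with probability `≥ 2/3`, a string with prefix `encodeNat a` (`g^a ≡ y mod p`) on every
encoded instance `⟨p, g, y⟩`. Consequently every FP generator of DLOG instances from uniform seeds,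
`gen s = encodeDLogInstance p g (g^a mod p)` with `ans s = encodeNat a`, satisfies (Q) (modulo the
classical-wrap plumbing of `WbwSearchToPromise`'s file), and X for it IS the average-case DLOG
assumption for that generator: an unconditional `¬ X` refutes every such assumption at once.
[cite: Shor1997, §6] -/
theorem dlog_clauseQ_shape :
    ∃ F : QCircuitFamily cliffordT, F.IsOracleFree ∧ F.IsUniform ∧
      ∀ x, 2 / 3 ≤ F.kernelProb 0 x {out | ∀ p g y : ℕ, x = encodeDLogInstance p g y →
        IsDLogInstance p g y → ∃ a ∈ dlogSolutions p g y, encodeNat a <+: out} :=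
  isQSolvable_dlog_holds

/-! ## §2 LOAD-BEARING `IsPPT`: unbounded adversaries win with probability one -/

/-- `WbwThesis` with the restriction `IsPPT A id` on the classical adversary DROPPED (clause (C)
demanded of EVERY `RandAlg`, i.e. of every function of (input, coins)). FALSE: see
`wbwThesis_false_without_PPT`. [folklore] -/
def WbwThesisWithoutPPT : Prop :=
  ∃ (gen ans : List Bool → List Bool), PolyTimeComputable id id gen ∧
    (∃ p : Polynomial ℕ, ∀ s, (ans s).length = p.eval (gen s).length) ∧
    ClauseQ gen ans ∧
    ∀ A : RandAlg (List Bool) (List Bool),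
      SuperpolynomialDecay atTop (fun n : ℕ => (n : ℝ)) (fun n : ℕ =>
        uniformAvg n fun s => A.pr id (boolPair (unaryEncodeNat n) (gen s)) {y | ans s <+: y})

/-- `RandAlg.pr` as a counting probability over the coin strings (tree lemma
`RandAlg.pr_eq_uniformProb`, re-derived to keep imports light). [folklore] -/
theorem pr_eq_uniformProb' {α β : Type} (A : RandAlg α β) (ea : α → List Bool) (x : α) (E : Set β) :
    A.pr ea x E = uniformProb (A.coinLen (ea x).length) {r : List Bool | A.run x r ∈ E} := by
  rw [uniformProb_eq_toOuterMeasure, RandAlg.pr, RandAlg.outputPMF, PMF.toOuterMeasure_map_apply]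
  rfl

open scoped Classical in
/-- The (information-theoretic, coin-free) TABLE ADVERSARY: on input `z`, if `z = ⟨1^{|s'|}, gen s'⟩`
for some seed `s'`, output `ans s'` (any choice), else `[]`. Well defined as an attack because answers
are a function of instances under (Q). [folklore] -/
noncomputable def tableAdversary (gen ans : List Bool → List Bool) : RandAlg (List Bool) (List Bool) where
  run z _ :=
    if h : ∃ s' : List Bool, boolPair (unaryEncodeNat s'.length) (gen s') = z then ans h.choose else []
  coinLen _ := 0

open scoped Classical in
/-- Under (Q) the table adversary outputs exactly `ans s` on `⟨1^{|s|}, gen s⟩` (every coin string).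
[folklore] -/
theorem tableAdversary_run_eq {gen ans : List Bool → List Bool} {p : Polynomial ℕ}
    (hp : ∀ s, (ans s).length = p.eval (gen s).length) {F : QCircuitFamily cliffordT}
    (hQ : ∀ s, 2 / 3 ≤ F.kernelProb 0 (gen s) {y | ans s <+: y}) (s r : List Bool) :
    (tableAdversary gen ans).run (boolPair (unaryEncodeNat s.length) (gen s)) r = ans s := by
  have h : ∃ s' : List Bool, boolPair (unaryEncodeNat s'.length) (gen s') =
      boolPair (unaryEncodeNat s.length) (gen s) := ⟨s, rfl⟩
  have hgen : gen h.choose = gen s := (QCircuit.boolPair_inj h.choose_spec).2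
  show (if h : ∃ s' : List Bool, boolPair (unaryEncodeNat s'.length) (gen s') =
      boolPair (unaryEncodeNat s.length) (gen s) then ans h.choose else []) = ans s
  rw [dif_pos h]
  exact ans_eq_of_gen_eq hp hQ hgen

/-- Under (Q) the table adversary outputs `ans s` on `⟨1^{|s|}, gen s⟩` with probability `1`.
[folklore] -/
theorem tableAdversary_pr {gen ans : List Bool → List Bool} {p : Polynomial ℕ}
    (hp : ∀ s, (ans s).length = p.eval (gen s).length) {F : QCircuitFamily cliffordT}
    (hQ : ∀ s, 2 / 3 ≤ F.kernelProb 0 (gen s) {y | ans s <+: y}) (s : List Bool) :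
    (tableAdversary gen ans).pr id (boolPair (unaryEncodeNat s.length) (gen s)) {y | ans s <+: y}
      = 1 := by
  rw [pr_eq_uniformProb']
  have hU : {r : List Bool | (tableAdversary gen ans).run (boolPair (unaryEncodeNat s.length) (gen s)) r
      ∈ {y : List Bool | ans s <+: y}} = Set.univ :=
    Set.eq_univ_of_forall fun r => by
      show ans s <+: (tableAdversary gen ans).run (boolPair (unaryEncodeNat s.length) (gen s)) r
      rw [tableAdversary_run_eq hp hQ s r]
  rw [hU, uniformProb_univ]

/-- **`IsPPT` is load-bearing**: for EVERY pair `(gen, ans)` satisfying (Q) (indeed for every pair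
whose answers are a function of the instances), clause (C) without the PPT restriction is FALSE —
the table adversary succeeds with probability `1` on every seed, so every uniform average is `1`.
[folklore] -/
theorem clauseC_false_forall_randAlg {gen ans : List Bool → List Bool} {p : Polynomial ℕ}
    (hp : ∀ s, (ans s).length = p.eval (gen s).length) {F : QCircuitFamily cliffordT}
    (hQ : ∀ s, 2 / 3 ≤ F.kernelProb 0 (gen s) {y | ans s <+: y}) :
    ¬ ∀ A : RandAlg (List Bool) (List Bool),
      SuperpolynomialDecay atTop (fun n : ℕ => (n : ℝ)) (fun n : ℕ =>
        uniformAvg n fun s => A.pr id (boolPair (unaryEncodeNat n) (gen s)) {y | ans s <+: y}) := by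
  intro hC
  refine not_superpolynomialDecay_of_frequently_le one_pos
    (Eventually.of_forall fun n => ?_).frequently (hC (tableAdversary gen ans))
  have h1 : ∀ x : List.Vector Bool n, (tableAdversary gen ans).pr id
      (boolPair (unaryEncodeNat n) (gen x.toList)) {y | ans x.toList <+: y} = 1 := fun x => by
    have := tableAdversary_pr hp hQ x.toList
    rwa [List.Vector.toList_length] at this
  simp only [uniformAvg, h1, Finset.sum_const, Finset.card_univ, card_vector, Fintype.card_bool,
    nsmul_eq_mul, mul_one]
  push_cast
  rw [div_self (by positivity)]

/-- **`¬ WbwThesisWithoutPPT`**: any proof of X must use the polynomial-time bound on the classical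
adversary — (C) is a purely computational lower bound (no entropy is left in `ans s` given `gen s`).
[folklore] -/
theorem wbwThesis_false_without_PPT : ¬ WbwThesisWithoutPPT := by
  rintro ⟨gen, ans, -, ⟨p, hp⟩, ⟨F, -, -, hQ⟩, hC⟩
  exact clauseC_false_forall_randAlg hp hQ hC

/-! ## §3 GUESSING BOUND: answers must be long; bounded-length ("decision-type") variants are false -/

/-- Evaluation of an `ℕ`-polynomial is monotone (local copy of a tree folklore lemma). [folklore] -/
theorem eval_mono_nat (q : Polynomial ℕ) {a b : ℕ} (h : a ≤ b) : q.eval a ≤ q.eval b := by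
  induction q using Polynomial.induction_on' with
  | add p q hp hq => simp only [Polynomial.eval_add]; exact Nat.add_le_add hp hq
  | monomial n c =>
    simp only [Polynomial.eval_monomial]
    exact Nat.mul_le_mul_left c (Nat.pow_le_pow_left h n)

/-- The COIN-ECHO (guessing) adversary with coin budget `q`: output the coin string. [folklore] -/
def guess (q : Polynomial ℕ) : RandAlg (List Bool) (List Bool) where
  run _ r := r
  coinLen m := q.eval m

/-- The guessing adversary is PPT (`⟨x, r⟩ ↦ r` is the tree's second pair projection
`polyTimeComputable_snd_holds`; coin budget `q`). [folklore] -/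
theorem guess_isPPT (q : Polynomial ℕ) : IsPPT (guess q) id := by
  refine ⟨?_, q, fun n => le_rfl⟩
  exact PolyTimeComputable.of_encode_eq (f := (Prod.snd : List Bool × List Bool → List Bool))
    (fun w : List Bool × List Bool => w) (fun _ => rfl) (fun _ => rfl) polyTimeComputable_snd_holds

/-- Exactly one string of length `|a|` equals `a`: `Pr_{r ∈ {0,1}^{|a|}}[r = a] = 2^{-|a|}`. [folklore] -/
theorem uniformProb_singleton_self (a : List Bool) :
    uniformProb a.length ({a} : Set (List Bool)) = 2⁻¹ ^ a.length := by
  classical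
  have hcard : ∀ (inst : DecidablePred fun r : List.Vector Bool a.length => r.toList ∈ ({a} : Set (List Bool))),
      (@Finset.filter _ (fun r : List.Vector Bool a.length => r.toList ∈ ({a} : Set (List Bool))) inst
        Finset.univ).card = 1 := by
    intro inst
    rw [Finset.card_eq_one]
    refine ⟨⟨a, rfl⟩, Finset.ext fun r => ?_⟩
    simp only [Finset.mem_filter, Finset.mem_univ, true_and, Set.mem_singleton_iff,
      Finset.mem_singleton]
    exact ⟨fun h => List.Vector.eq _ _ h, fun h => h ▸ rfl⟩
  unfold uniformProb
  rw [hcard, Nat.cast_one, one_div, inv_pow]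

/-- **Success probability of guessing**: on any input `z`, the coin-echo adversary outputs a string
with prefix `a` with probability exactly `2^{-|a|}`, provided its coin budget covers `|a|`.
[folklore] -/
theorem guess_pr (q : Polynomial ℕ) (z a : List Bool) (ha : a.length ≤ q.eval z.length) :
    (guess q).pr id z {y | a <+: y} = 2⁻¹ ^ a.length := by
  rw [pr_eq_uniformProb']
  have hE : {r : List Bool | (guess q).run z r ∈ {y : List Bool | a <+: y}} =
      {r | r.take a.length ∈ ({a} : Set (List Bool))} := by
    ext r
    simp only [guess, Set.mem_setOf_eq, Set.mem_singleton_iff]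
    rw [List.prefix_iff_eq_take]
    exact eq_comm
  rw [hE]
  exact (uniformProb_take_of_le ha _).trans (uniformProb_singleton_self a)

/-- **Answer-length decay is necessary.** If `|ans s| ≤ p(|gen s|)` for all `s` (in X: equality) and
clause (C) holds for `(gen, ans)`, then `n ↦ E_{s ∈ {0,1}ⁿ}[2^{-|ans s|}]` decays superpolynomially:
it IS the success probability of the PPT guessing adversary with coin budget `p` (the instance
`⟨1ⁿ, gen s⟩` is longer than `gen s`, so the budget `p(|⟨1ⁿ, gen s⟩|) ≥ p(|gen s|) ≥ |ans s|`
suffices). [folklore] -/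
theorem answerLength_decay_of_clauseC {gen ans : List Bool → List Bool} {p : Polynomial ℕ}
    (hp : ∀ s, (ans s).length ≤ p.eval (gen s).length) (hC : ClauseC gen ans) :
    SuperpolynomialDecay atTop (fun n : ℕ => (n : ℝ))
      (fun n : ℕ => uniformAvg n fun s => (2⁻¹ : ℝ) ^ (ans s).length) := by
  have h := hC (guess p) (guess_isPPT p)
  refine (congrArg (SuperpolynomialDecay atTop (fun n : ℕ => (n : ℝ))) (funext fun n => ?_)).mp h
  refine congrArg (fun g => uniformAvg n g) (funext fun s => guess_pr p _ _ ((hp s).trans ?_))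
  exact eval_mono_nat p (by simp)

/-- **Short answers kill (C).** If on infinitely many lengths `n` EVERY seed of length `n` has an answer
of at most `k · log₂ n` bits, clause (C) fails (guessing succeeds with probability `≥ n^{-k}` there).
[folklore] -/
theorem clauseC_false_of_log_answers {gen ans : List Bool → List Bool} {p : Polynomial ℕ}
    (hp : ∀ s, (ans s).length ≤ p.eval (gen s).length) (k : ℕ)
    (h : ∃ᶠ n in atTop, ∀ s : List Bool, s.length = n → (ans s).length ≤ k * Nat.log 2 n) :
    ¬ ClauseC gen ans := by
  intro hC
  have hdec := (answerLength_decay_of_clauseC hp hC) k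
  -- along the frequent lengths, `n^k * avg ≥ 1`
  have hfreq : ∃ᶠ n : ℕ in atTop, (1 : ℝ) ≤ (n : ℝ) ^ k * uniformAvg n fun s => (2⁻¹ : ℝ) ^ (ans s).length := by
    refine (h.and_eventually (eventually_ge_atTop 1)).mono fun n ⟨hn, hn1⟩ => ?_
    have hpt : ∀ s : List Bool, s.length = n → (1 : ℝ) ≤ (n : ℝ) ^ k * (2⁻¹ : ℝ) ^ (ans s).length := by
      intro s hs
      have h2 : (2⁻¹ : ℝ) ^ (k * Nat.log 2 n) ≤ (2⁻¹ : ℝ) ^ (ans s).length :=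
        pow_le_pow_of_le_one (by norm_num) (by norm_num) (hn s hs)
      have h3 : (1 : ℝ) ≤ (n : ℝ) ^ k * (2⁻¹ : ℝ) ^ (k * Nat.log 2 n) := by
        rw [pow_mul', ← mul_pow, inv_pow, ← div_eq_mul_inv]
        refine one_le_pow₀ ?_
        rw [le_div_iff₀ (by positivity), one_mul]
        exact_mod_cast Nat.pow_log_le_self 2 (by omega)
      exact h3.trans (mul_le_mul_of_nonneg_left h2 (by positivity))
    calc (1 : ℝ) = uniformAvg n fun _ => 1 := by
            simp [uniformAvg, card_vector]
      _ ≤ uniformAvg n fun s => (n : ℝ) ^ k * (2⁻¹ : ℝ) ^ (ans s).length := by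
            unfold uniformAvg
            exact div_le_div_of_nonneg_right (Finset.sum_le_sum fun x _ => hpt x.toList (by simp))
              (by positivity)
      _ = (n : ℝ) ^ k * uniformAvg n fun s => (2⁻¹ : ℝ) ^ (ans s).length := by
            simp only [uniformAvg, ← Finset.mul_sum, mul_div_assoc]
  have hev : ∀ᶠ n : ℕ in atTop, (n : ℝ) ^ k * uniformAvg n (fun s => (2⁻¹ : ℝ) ^ (ans s).length) < 1 :=
    hdec.eventually (gt_mem_nhds one_pos)
  obtain ⟨n, hn, hlt⟩ := (hfreq.and_eventually hev).exists
  exact absurd hlt (not_lt.2 hn)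

/-- `WbwThesis` with the polynomial answer length replaced by a CONSTANT BOUND `|ans s| ≤ k`
(the "decision-type" / finitely-many-answer-bits variant). FALSE: `not_wbwThesisBoundedAnswers`.
[folklore] -/
def WbwThesisBoundedAnswers : Prop :=
  ∃ (gen ans : List Bool → List Bool), PolyTimeComputable id id gen ∧
    (∃ k : ℕ, ∀ s, (ans s).length ≤ k) ∧ ClauseQ gen ans ∧ ClauseC gen ans

/-- **The bounded-answer variant is false** (whatever `gen` and the quantum family): guessing `k`
coins succeeds with probability `≥ 2^{-k}` on every seed, a constant. In particular a ONE-BIT answer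
(a planted DECISION problem) can never satisfy (C) as typed — X is irreducibly a search statement,
and the route's passage to promise DECISION problems (`WbwSearchToPromise`) is where worst-case
quantifiers replace the average. [folklore] -/
theorem not_wbwThesisBoundedAnswers : ¬ WbwThesisBoundedAnswers := by
  rintro ⟨gen, ans, -, ⟨k, hk⟩, -, hC⟩
  have hp : ∀ s, (ans s).length ≤ (Polynomial.C k : Polynomial ℕ).eval (gen s).length := fun s => by
    simpa using hk s
  have hdec := (answerLength_decay_of_clauseC hp hC) 0
  simp only [pow_zero, one_mul] at hdec
  have hev : ∀ᶠ n : ℕ in atTop, uniformAvg n (fun s => (2⁻¹ : ℝ) ^ (ans s).length) < (2⁻¹ : ℝ) ^ k :=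
    hdec.eventually (gt_mem_nhds (by positivity))
  obtain ⟨n, hn⟩ := hev.exists
  refine absurd hn (not_lt.2 ?_)
  calc (2⁻¹ : ℝ) ^ k = uniformAvg n fun _ => (2⁻¹ : ℝ) ^ k := by
          simp only [uniformAvg, Finset.sum_const, Finset.card_univ, card_vector, Fintype.card_bool,
            nsmul_eq_mul]
          push_cast
          rw [eq_div_iff (by positivity), mul_comm]
    _ ≤ uniformAvg n fun s => (2⁻¹ : ℝ) ^ (ans s).length := by
          unfold uniformAvg
          exact div_le_div_of_nonneg_right (Finset.sum_le_sum fun x _ =>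
            pow_le_pow_of_le_one (by norm_num) (by norm_num) (hk _)) (by positivity)

/-! ## §4 PLANTED ⇒ ONE-WAY: with answers in FP, (Q)+(C) make the generator a one-way function -/

/-- Post-composition of a randomized algorithm with a deterministic map (same coins). [folklore] -/
def postCompose (f : List Bool → List Bool) (A : RandAlg (List Bool) (List Bool)) :
    RandAlg (List Bool) (List Bool) where
  run z r := f (A.run z r)
  coinLen := A.coinLen

/-- PPT is preserved by FP post-processing (tree: `PolyTimeComputable.comp_holds`). [folklore] -/
theorem postCompose_isPPT {f : List Bool → List Bool} (hf : PolyTimeComputable id id f)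
    {A : RandAlg (List Bool) (List Bool)} (hA : IsPPT A id) : IsPPT (postCompose f A) id :=
  ⟨PolyTimeComputable.comp_holds hf hA.1, hA.2⟩

/-- Monotonicity of `RandAlg.pr` along an implication between output events of two algorithms with
the same coins: if every coin string that puts `A`'s output in `S` puts `B`'s output in `E`, then
`Pr[A ∈ S] ≤ Pr[B ∈ E]`. [folklore] -/
theorem pr_le_pr_of_imp {A B : RandAlg (List Bool) (List Bool)} (hcoin : A.coinLen = B.coinLen)
    (z : List Bool) {S E : Set (List Bool)} (h : ∀ r, A.run z r ∈ S → B.run z r ∈ E) :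
    A.pr id z S ≤ B.pr id z E := by
  classical
  rw [pr_eq_uniformProb', pr_eq_uniformProb', hcoin]
  unfold uniformProb
  refine div_le_div_of_nonneg_right ?_ (by positivity)
  exact_mod_cast Finset.card_le_card fun r hr => by
    simp only [Finset.mem_filter, Finset.mem_univ, true_and, Set.mem_setOf_eq] at hr ⊢
    exact h _ hr

/-- **Planted X makes the generator one-way.** If `gen, ans ∈ FP`, (Q) holds (so answers are a
function of instances, `ans_eq_of_gen_eq`) and (C) holds, then `gen` is a (strong) one-way function:
a PPT inverter `A` finding SOME preimage `s'` of `gen s` with probability `ε(n)` yields the PPT solver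
`ans ∘ A` with success `≥ ε(n)` (`ans s' = ans s`), so `ε` is negligible. Consequences: the planted
thesis implies OWF (hence `NP ⊄ BPP`; no unconditional proof), and for the intended witness
(crux `WbwObfuscatedGluedTrees`) "`(iO(N_k), name_k(ENTRANCE))` hides the seed" is a NECESSARY
condition, testable without any iO security notion. [cite: Goldreich2001, Def. 2.2.1] -/
theorem isOneWay_gen_of_planted {gen ans : List Bool → List Bool} (hgen : PolyTimeComputable id id gen)
    (hans : PolyTimeComputable id id ans) {p : Polynomial ℕ}
    (hp : ∀ s, (ans s).length = p.eval (gen s).length) {F : QCircuitFamily cliffordT}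
    (hQ : ∀ s, 2 / 3 ≤ F.kernelProb 0 (gen s) {y | ans s <+: y}) (hC : ClauseC gen ans) :
    IsOneWay gen := by
  refine ⟨hgen, fun A hA => ?_⟩
  have hB := hC (postCompose ans A) (postCompose_isPPT hans hA)
  refine hB.trans_abs_le fun n => ?_
  rw [abs_of_nonneg (invertProb_nonneg _ _ _),
    abs_of_nonneg (uniformAvg_nonneg fun _ => RandAlg.pr_nonneg _ _ _ _)]
  unfold invertProb uniformAvg
  refine div_le_div_of_nonneg_right (Finset.sum_le_sum fun x _ => ?_) (by positivity)
  dsimp only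
  refine pr_le_pr_of_imp (A := A) (B := postCompose ans A) rfl _ fun r hr => ?_
  have e : ans (A.run (boolPair (unaryEncodeNat n) (gen x.toList)) r) = ans x.toList :=
    ans_eq_of_gen_eq hp hQ hr
  show ans x.toList <+: ans (A.run (boolPair (unaryEncodeNat n) (gen x.toList)) r)
  exact ⟨[], by rw [List.append_nil, e]⟩

/-- The PLANTED thesis: X with, in addition, `ans ∈ FP` (answers efficiently computable from the
seed, as for every "planted" instance generator, e.g. `ans s = name_k(EXIT)`). It implies X by
dropping the extra conjunct (not stated as a theorem here: a positive `WbwThesis` conclusion belongs to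
provers). [folklore] -/
def WbwThesisPlanted : Prop :=
  ∃ (gen ans : List Bool → List Bool), PolyTimeComputable id id gen ∧ PolyTimeComputable id id ans ∧
    (∃ p : Polynomial ℕ, ∀ s, (ans s).length = p.eval (gen s).length) ∧
    ClauseQ gen ans ∧ ClauseC gen ans

/-- **Planted X ⇒ one-way functions exist** (so the planted thesis, the form every intended witness
has, is at least as strong as `∃ OWF` and admits no unconditional proof; dually an unconditional
refutation of X refutes every planted witness, e.g. every FP-samplable average-case-hard DLOG
generator, by §1). [cite: Goldreich2001, Def. 2.2.1] -/
theorem exists_isOneWay_of_wbwThesisPlanted (h : WbwThesisPlanted) : ∃ f, IsOneWay f := by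
  obtain ⟨gen, ans, hgen, hans, ⟨p, hp⟩, ⟨F, -, -, hQ⟩, hC⟩ := h
  exact ⟨gen, isOneWay_gen_of_planted hgen hans hp hQ hC⟩

/-! ## §6 SURPLUS STRENGTH: the route consumes only WORST-CASE classical hardness -/

/-- The WORST-CASE classical clause: no PPT algorithm outputs `ans s` with probability `≥ 2/3` on
EVERY instance `⟨1^{|s|}, gen s⟩`. This is all the glue `WbwSearchToPromise` extracts from (C) (its PPT
built from `PromiseBQP ⊆ PromiseBPP'` succeeds on every seed with probability `≥ 2/3`). [folklore] -/
def ClauseCwc (gen ans : List Bool → List Bool) : Prop :=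
  ¬ ∃ A : RandAlg (List Bool) (List Bool), IsPPT A id ∧
      ∀ s, 2 / 3 ≤ A.pr id (boolPair (unaryEncodeNat s.length) (gen s)) {y | ans s <+: y}

/-- Uniform averages are monotone under a pointwise bound on strings of the averaged length.
[folklore] -/
theorem le_uniformAvg_of_forall {n : ℕ} {g : List Bool → ℝ} {c : ℝ}
    (h : ∀ s : List Bool, s.length = n → c ≤ g s) : c ≤ uniformAvg n g := by
  calc c = uniformAvg n fun _ => c := by
        simp only [uniformAvg, Finset.sum_const, Finset.card_univ, card_vector, Fintype.card_bool,
          nsmul_eq_mul]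
        push_cast
        rw [eq_div_iff (by positivity), mul_comm]
    _ ≤ uniformAvg n g := by
        unfold uniformAvg
        exact div_le_div_of_nonneg_right (Finset.sum_le_sum fun x _ => h x.toList (by simp))
          (by positivity)

/-- **(C) is stronger than what the route uses**: average-case negligible success implies worst-case
failure (`ClauseC → ClauseCwc`), and the deciding theorem `WhiteBoxWalk.closes` consumes X only through
`WbwSearchToPromise`, whose proof needs no more than `ClauseCwc`. Information for the planner
("hypothesis possibly unnecessary"): the target could be weakened to `∃ gen ans, FP ∧ length ∧ (Q) ∧
ClauseCwc` — a samplable-promise form of `PromiseBQP ⊄ PromiseBPP` — without touching the assembly; the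
average-case surplus is exactly what makes X a CRYPTOGRAPHIC (OWF-strength, §4) rather than a
complexity-theoretic separation. [folklore] -/
theorem clauseCwc_of_clauseC {gen ans : List Bool → List Bool} (hC : ClauseC gen ans) :
    ClauseCwc gen ans := by
  rintro ⟨A, hA, hwin⟩
  refine not_superpolynomialDecay_of_frequently_le (by norm_num : (0 : ℝ) < 2 / 3)
    (Eventually.of_forall fun n => ?_).frequently (hC A hA)
  exact le_uniformAvg_of_forall fun s hs => by simpa [hs] using hwin s

/-! ## §7 LOAD-BEARING (Q), formally: with (Q) dropped the statement is a THEOREM (diagonal answers) -/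

section Diagonal

/-- `|1ⁿ| = n`. [folklore] -/
theorem length_unaryEncodeNat' (n : ℕ) : (unaryEncodeNat n).length = n := by
  induction n with
  | zero => rfl
  | succ n ih => simp [unaryEncodeNat, ih]

/-- The set of run maps of PPT algorithms (polynomial time on the pair presentation `⟨x, r⟩`).
[cite: AroraBarak2009, Def. 7.1] -/
def pptRuns : Set (List Bool → List Bool → List Bool) :=
  {ρ | PolyTimeComputable (fun w : List Bool × List Bool => boolPair w.1 w.2) (id : List Bool → List Bool)
    (Function.uncurry ρ)}

/-- There are countably many PPT run maps (tree: `countable_setOf_polyTimeComputable`, "machines as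
strings"). [cite: AroraBarak2009, §1.4] -/
theorem pptRuns_countable : pptRuns.Countable := by
  have h := countable_setOf_polyTimeComputable (α := List Bool × List Bool) (β := List Bool)
    (fun w : List Bool × List Bool => boolPair w.1 w.2) (eb := (id : List Bool → List Bool))
    Function.injective_id
  exact Set.MapsTo.countable_of_injOn (f := Function.uncurry) (fun ρ hρ => hρ)
    (Function.uncurry_injective.injOn) h

/-- The coin-echo run map is PPT, so `pptRuns` is nonempty. [folklore] -/
theorem pptRuns_nonempty : pptRuns.Nonempty :=
  ⟨(guess Polynomial.X).run, (guess_isPPT Polynomial.X).1⟩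

/-- A fixed enumeration `ρ₀, ρ₁, …` of all PPT run maps. [cite: AroraBarak2009, §1.4] -/
noncomputable def runEnum : ℕ → (List Bool → List Bool → List Bool) :=
  (pptRuns_countable.exists_eq_range pptRuns_nonempty).choose

/-- `pptRuns` is the range of the fixed enumeration `runEnum`. [folklore] -/
theorem pptRuns_eq_range_runEnum : pptRuns = Set.range runEnum :=
  (pptRuns_countable.exists_eq_range pptRuns_nonempty).choose_spec

/-- Level-`n` success of a run map `ρ` with `c` coins against the candidate answer `a`, for the
instance map `gen`: `E_{s ∈ {0,1}ⁿ} Pr_{r ∈ {0,1}^c}[a ⊑ ρ(⟨1ⁿ, gen s⟩, r)]`. [folklore] -/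
noncomputable def succ (gen : List Bool → List Bool) (ρ : List Bool → List Bool → List Bool) (c n : ℕ)
    (a : List Bool) : ℝ :=
  uniformAvg n fun s => uniformProb c {r | a <+: ρ (boolPair (unaryEncodeNat n) (gen s)) r}

/-- Successes are nonnegative. [folklore] -/
theorem succ_nonneg (gen : List Bool → List Bool) (ρ : List Bool → List Bool → List Bool) (c n : ℕ)
    (a : List Bool) : 0 ≤ succ gen ρ c n a :=
  uniformAvg_nonneg fun _ => uniformProb_nonneg _ _

/-- `uniformProb` as a normalised sum of indicators (any decidability instance). [folklore] -/
theorem uniformProb_eq_sum_ite (m : ℕ) (E : Set (List Bool)) [DecidablePred (· ∈ E)] :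
    uniformProb m E = (∑ r : List.Vector Bool m, if r.toList ∈ E then (1 : ℝ) else 0) / 2 ^ m := by
  classical
  unfold uniformProb
  rw [Finset.sum_boole]
  congr

/-- **Disjoint prefixes**: for a fixed map `f` of the coins, the events "`f r` has prefix `a`",
`a ∈ {0,1}ⁿ`, are pairwise disjoint, so their probabilities sum to at most `1`. [folklore] -/
theorem sum_uniformProb_prefix_le_one (c n : ℕ) (f : List Bool → List Bool) :
    ∑ a : List.Vector Bool n, uniformProb c {r | a.toList <+: f r} ≤ 1 := by
  classical
  simp only [uniformProb_eq_sum_ite, Set.mem_setOf_eq]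
  rw [← Finset.sum_div, div_le_one (by positivity), Finset.sum_comm]
  calc ∑ r : List.Vector Bool c, ∑ a : List.Vector Bool n, (if a.toList <+: f r.toList then (1 : ℝ) else 0)
      ≤ ∑ _r : List.Vector Bool c, (1 : ℝ) := Finset.sum_le_sum fun r _ => by
        rw [Finset.sum_boole, Nat.cast_le_one]
        refine Finset.card_le_one.2 fun a ha b hb => ?_
        simp only [Finset.mem_filter, Finset.mem_univ, true_and] at ha hb
        exact List.Vector.eq _ _ ((List.prefix_of_prefix_length_le ha hb (by simp)).eq_of_length (by simp))
    _ = 2 ^ c := by simp [card_vector]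

/-- Summed over all candidate answers of length `n`, level-`n` successes total at most `1`.
[folklore] -/
theorem sum_succ_le_one (gen : List Bool → List Bool) (ρ : List Bool → List Bool → List Bool) (c n : ℕ) :
    ∑ a : List.Vector Bool n, succ gen ρ c n a.toList ≤ 1 := by
  simp only [succ, uniformAvg]
  rw [← Finset.sum_div, Finset.sum_comm, div_le_one (by positivity)]
  calc ∑ x : List.Vector Bool n, ∑ a : List.Vector Bool n,
        uniformProb c {r | a.toList <+: ρ (boolPair (unaryEncodeNat n) (gen x.toList)) r}
      ≤ ∑ _x : List.Vector Bool n, (1 : ℝ) :=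
        Finset.sum_le_sum fun x _ => sum_uniformProb_prefix_le_one c n _
    _ = 2 ^ n := by simp [card_vector]

/-- **Selection by averaging**: against fewer than `2ⁿ ε` (run map, coin count) pairs some answer of
length `n` keeps every success below `ε`. [folklore] -/
theorem exists_good_answer (gen : List Bool → List Bool) {ι : Type} (J : Finset ι)
    (ρ : ι → List Bool → List Bool → List Bool) (c : ι → ℕ) (n : ℕ) {ε : ℝ}
    (hJ : (J.card : ℝ) < 2 ^ n * ε) :
    ∃ a : List.Vector Bool n, ∀ j ∈ J, succ gen (ρ j) (c j) n a.toList < ε := by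
  by_contra h
  simp only [not_exists, not_forall, not_lt] at h
  have h1 : (2 : ℝ) ^ n * ε ≤ ∑ a : List.Vector Bool n, ∑ j ∈ J, succ gen (ρ j) (c j) n a.toList := by
    calc (2 : ℝ) ^ n * ε = ∑ _a : List.Vector Bool n, ε := by simp [card_vector]
      _ ≤ _ := Finset.sum_le_sum fun a _ => by
          obtain ⟨j, hj, hle⟩ := h a
          exact hle.trans (Finset.single_le_sum (fun j _ => succ_nonneg _ _ _ _ _) hj)
  have h2 : ∑ a : List.Vector Bool n, ∑ j ∈ J, succ gen (ρ j) (c j) n a.toList ≤ J.card := by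
    rw [Finset.sum_comm]
    calc ∑ j ∈ J, ∑ a : List.Vector Bool n, succ gen (ρ j) (c j) n a.toList ≤ ∑ _j ∈ J, (1 : ℝ) :=
          Finset.sum_le_sum fun j _ => sum_succ_le_one _ _ _ _
      _ = J.card := by simp
  linarith

/-- The level-`n` family: the first `n` PPT run maps with every coin count below `2^{⌊n/2⌋}`. [folklore] -/
noncomputable def levelFamily (n : ℕ) : Finset (ℕ × ℕ) := Finset.range n ×ˢ Finset.range (2 ^ (n / 2))

/-- The level-`n` threshold `εₙ = (n·2^{⌊n/2⌋} + 1)/2ⁿ`. [folklore] -/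
noncomputable def eps (n : ℕ) : ℝ := ((n * 2 ^ (n / 2) + 1 : ℕ) : ℝ) / 2 ^ n

/-- The level-`n` family has fewer than `2ⁿ εₙ` members (by one). [folklore] -/
theorem card_levelFamily_lt (n : ℕ) : ((levelFamily n).card : ℝ) < 2 ^ n * eps n := by
  unfold levelFamily eps
  rw [Finset.card_product, Finset.card_range, Finset.card_range, mul_div_cancel₀ _ (by positivity)]
  exact_mod_cast Nat.lt_succ_self _

/-- **The diagonal answer** of length `n` (for the instance map `gen`): below `εₙ` against the whole
level-`n` family. [folklore] -/
noncomputable def bad (gen : List Bool → List Bool) (n : ℕ) : List.Vector Bool n :=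
  (exists_good_answer gen (levelFamily n) (fun j => runEnum j.1) (fun j => j.2) n
    (card_levelFamily_lt n)).choose

/-- The defining property of the diagonal answer. [folklore] -/
theorem bad_spec (gen : List Bool → List Bool) (n : ℕ) :
    ∀ j ∈ levelFamily n, succ gen (runEnum j.1) j.2 n (bad gen n).toList < eps n :=
  (exists_good_answer gen (levelFamily n) (fun j => runEnum j.1) (fun j => j.2) n
    (card_levelFamily_lt n)).choose_spec

/-- `p(m)/2^m → 0` superpolynomially for an `ℕ`-polynomial `p` (twin of the tree's
`superpolynomialDecay_natPoly_div_two_pow`). [folklore] -/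
theorem superpolynomialDecay_natPoly_div_two_pow' (P : Polynomial ℕ) :
    SuperpolynomialDecay atTop (fun n : ℕ => (n : ℝ)) (fun n => ((P.eval n : ℕ) : ℝ) / 2 ^ n) := by
  have h0 : SuperpolynomialDecay atTop (fun n : ℕ => (n : ℝ)) (fun n => ((1 : ℝ) / 2) ^ n) := by
    intro m
    exact tendsto_pow_const_mul_const_pow_of_abs_lt_one m (r := (1 : ℝ) / 2)
      (by rw [abs_of_pos (by norm_num)]; norm_num)
  refine (h0.polynomial_mul (P.map (Nat.castRingHom ℝ))).congr fun n => ?_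
  rw [Polynomial.eval_map, Polynomial.eval₂_at_natCast, one_div_pow]
  simp only [eq_natCast, Nat.cast_id]
  ring

/-- `⌊n/2⌋ → ∞`. [folklore] -/
theorem tendsto_half : Tendsto (fun n : ℕ => n / 2) atTop atTop :=
  Filter.tendsto_atTop_atTop.2 fun b => ⟨2 * b, fun n hn => by omega⟩

/-- **`εₙ` is negligible**: `n^k εₙ ≤ (2m+2)^{k+1}/2^m` with `m = ⌊n/2⌋`. [folklore] -/
theorem eps_superpolynomialDecay : SuperpolynomialDecay atTop (fun n : ℕ => (n : ℝ)) eps := by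
  intro k
  have hG := (superpolynomialDecay_natPoly_div_two_pow' ((2 * Polynomial.X + 2) ^ (k + 1)) 0).comp
    tendsto_half
  simp only [pow_zero, one_mul] at hG
  refine squeeze_zero (fun n => by unfold eps; positivity) (fun n => ?_) hG
  have hn : n ≤ 2 * (n / 2) + 1 := by omega
  have hsub : n / 2 ≤ n - n / 2 := by omega
  simp only [Function.comp_apply, Polynomial.eval_pow, Polynomial.eval_add, Polynomial.eval_mul,
    Polynomial.eval_ofNat, Polynomial.eval_X, eps]
  rw [mul_div_assoc', div_le_div_iff₀ (by positivity) (by positivity)]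
  have h1 : (n : ℝ) ^ k * ((n * 2 ^ (n / 2) + 1 : ℕ) : ℝ) ≤ (((2 * (n / 2) + 2) ^ (k + 1) : ℕ) : ℝ) * 2 ^ (n / 2) := by
    have : n ^ k * (n * 2 ^ (n / 2) + 1) ≤ (2 * (n / 2) + 2) ^ (k + 1) * 2 ^ (n / 2) := by
      have h3 : n * 2 ^ (n / 2) + 1 ≤ (2 * (n / 2) + 2) * 2 ^ (n / 2) := by
        have := Nat.one_le_two_pow (n := n / 2); nlinarith
      calc n ^ k * (n * 2 ^ (n / 2) + 1) ≤ (2 * (n / 2) + 2) ^ k * ((2 * (n / 2) + 2) * 2 ^ (n / 2)) :=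
            Nat.mul_le_mul (Nat.pow_le_pow_left (by omega) k) h3
        _ = (2 * (n / 2) + 2) ^ (k + 1) * 2 ^ (n / 2) := by ring
    exact_mod_cast this
  have h2 : (2 : ℝ) ^ (n / 2) * 2 ^ (n / 2) ≤ 2 ^ n := by
    rw [← pow_add]; exact pow_le_pow_right₀ (by norm_num) (by omega)
  calc (n : ℝ) ^ k * ((n * 2 ^ (n / 2) + 1 : ℕ) : ℝ) * 2 ^ (n / 2)
      ≤ (((2 * (n / 2) + 2) ^ (k + 1) : ℕ) : ℝ) * 2 ^ (n / 2) * 2 ^ (n / 2) :=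
        mul_le_mul_of_nonneg_right h1 (by positivity)
    _ ≤ (((2 * (n / 2) + 2) ^ (k + 1) : ℕ) : ℝ) * 2 ^ n := by
        rw [mul_assoc]; exact mul_le_mul_of_nonneg_left h2 (by positivity)

/-- A polynomial coin budget on instances of length `3n+2` is eventually below the level-`n` coin cap
`2^{⌊n/2⌋}`. [folklore] -/
theorem eventually_coinBudget_lt (p : Polynomial ℕ) : ∀ᶠ n : ℕ in atTop, p.eval (3 * n + 2) < 2 ^ (n / 2) := by
  have hq := (superpolynomialDecay_natPoly_div_two_pow' (p.comp (6 * Polynomial.X + 5)) 0).comp tendsto_half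
  simp only [pow_zero, one_mul] at hq
  have hev := hq.eventually (gt_mem_nhds one_pos)
  refine hev.mono fun n hn => ?_
  simp only [Function.comp_apply, Polynomial.eval_comp, Polynomial.eval_add, Polynomial.eval_mul,
    Polynomial.eval_ofNat, Polynomial.eval_X] at hn
  rw [div_lt_one (by positivity)] at hn
  have h1 : p.eval (3 * n + 2) ≤ p.eval (6 * (n / 2) + 5) := eval_mono_nat p (by omega)
  have h2 : ((p.eval (6 * (n / 2) + 5) : ℕ) : ℝ) < (2 : ℝ) ^ (n / 2) := hn
  have h3 : p.eval (6 * (n / 2) + 5) < 2 ^ (n / 2) := by exact_mod_cast h2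
  exact h1.trans_lt h3

/-- The diagonal answer map for the instance map `gen`: `ans s = bad gen |s|` (a function of the
length only). [folklore] -/
noncomputable def diagAns (gen : List Bool → List Bool) (s : List Bool) : List Bool := (bad gen s.length).toList

/-- **Level-`n` success of a PPT algorithm against `diagAns gen` is its `succ` at
`(run, coinLen (3n+2))`**, for a length-preserving `gen`. [folklore] -/
theorem uniformAvg_pr_eq_succ {gen : List Bool → List Bool} (hlen : ∀ s, (gen s).length = s.length)
    (A : RandAlg (List Bool) (List Bool)) (n : ℕ) :
    uniformAvg n (fun s => A.pr id (boolPair (unaryEncodeNat n) (gen s)) {y | diagAns gen s <+: y}) =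
      succ gen A.run (A.coinLen (3 * n + 2)) n (bad gen n).toList := by
  unfold succ uniformAvg
  congr 1
  refine Finset.sum_congr rfl fun x _ => ?_
  show A.pr id (boolPair (unaryEncodeNat n) (gen x.toList)) {y | diagAns gen x.toList <+: y} =
    uniformProb (A.coinLen (3 * n + 2))
      {r | (bad gen n).toList <+: A.run (boolPair (unaryEncodeNat n) (gen x.toList)) r}
  rw [pr_eq_uniformProb']
  have hlen' : (id (boolPair (unaryEncodeNat n) (gen x.toList))).length = 3 * n + 2 := by
    simp only [id, length_boolPair, length_unaryEncodeNat', hlen, List.Vector.toList_length]; ring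
  rw [hlen']
  have hbad : ∀ m, m = n → (bad gen m).toList = (bad gen n).toList := by rintro m rfl; rfl
  simp only [Set.mem_setOf_eq, diagAns, hbad _ (List.Vector.toList_length x)]

/-- **Clause (C) holds for `(gen, diagAns gen)`** whenever `gen` preserves lengths: a PPT `A` has run
map `ρᵢ` and coin budget `≤ p`; for `n > i` with `p(3n+2) < 2^{⌊n/2⌋}` the pair `(i, coinLen (3n+2))`
lies in the level-`n` family, so `A`'s success is `< εₙ`, negligible. [folklore] -/
theorem clauseC_diagAns {gen : List Bool → List Bool} (hlen : ∀ s, (gen s).length = s.length) :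
    ClauseC gen (diagAns gen) := by
  intro A hA
  obtain ⟨hrun, p, hp⟩ := hA
  have hmem : A.run ∈ pptRuns := hrun
  rw [pptRuns_eq_range_runEnum] at hmem
  obtain ⟨i, hi⟩ := hmem
  have hev : ∀ᶠ n : ℕ in atTop, uniformAvg n (fun s => A.pr id (boolPair (unaryEncodeNat n) (gen s))
      {y | diagAns gen s <+: y}) < eps n := by
    filter_upwards [eventually_gt_atTop i, eventually_coinBudget_lt p] with n hin hcoin
    rw [uniformAvg_pr_eq_succ hlen]
    have hj : (i, A.coinLen (3 * n + 2)) ∈ levelFamily n := by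
      simp only [levelFamily, Finset.mem_product, Finset.mem_range]
      exact ⟨hin, (hp _).trans_lt hcoin⟩
    have := bad_spec gen n _ hj
    rwa [hi] at this
  refine eps_superpolynomialDecay.trans_eventually_abs_le (hev.mono fun n hn => ?_)
  simp only [Function.comp_apply]
  rw [abs_of_nonneg (uniformAvg_nonneg fun _ => RandAlg.pr_nonneg _ _ _ _),
    abs_of_nonneg (by unfold eps; positivity)]
  exact hn.le

/-- **X with clause (Q) DROPPED is a theorem** (`gen = id`, `p = X`, `ans = diagAns id`): a poly-time
generator and answers of polynomial length that every PPT algorithm finds with negligible probability on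
average exist unconditionally. So clause (Q) carries ALL the content of X: classical average-case
hardness of polynomial-length unique answers is available for free (non-constructively, Kolmogorov
style), and only the demand that ONE uniform quantum family finds these very answers makes X a
statement about computation. Any mutant of X whose quantum clause does not pin `ans` down is trivial
for this reason. [folklore] -/
theorem wbwThesisWithoutQ_holds :
    ∃ (gen ans : List Bool → List Bool), PolyTimeComputable id id gen ∧
      (∃ p : Polynomial ℕ, ∀ s, (ans s).length = p.eval (gen s).length) ∧ ClauseC gen ans :=
  ⟨id, diagAns id, PolyTimeComputable.id _, ⟨Polynomial.X, fun s => by simp [diagAns]⟩,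
    clauseC_diagAns fun _ => rfl⟩

end Diagonal

/-! ## §8 LOAD-BEARING uniformity, formally: with `F.IsUniform` dropped the statement is a THEOREM -/

section NonUniform

open Literature.Computability.QuantumComplexity

/-- The all-zeros finite-state transducer (twin of the tree's `Kannan.zerosT`, restated to avoid a
heavy import): every input symbol becomes `0`. [folklore] -/
def zerosT' : FST Unit Bool Bool where
  init := ()
  step := fun _ _ => ((), [false])
  front := fun _ => []
  keep := fun _ => true

/-- `zerosT'` outputs `0^{|w|}`. [folklore] -/
theorem zerosT'_eval (w : List Bool) : zerosT'.eval w = List.replicate w.length false := by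
  have h : ∀ w : List Bool, (zerosT'.run () w).2 = List.replicate w.length false := by
    intro w
    induction w with
    | nil => rfl
    | cons b w ih =>
      rw [FST.run_cons, List.length_cons, List.replicate_succ]
      exact congrArg (List.cons false) ih
  have he : zerosT'.eval w = zerosT'.front (zerosT'.run zerosT'.init w).1 ++ (zerosT'.run zerosT'.init w).2 := by
    simp [FST.eval, zerosT']
  rw [he, show zerosT'.init = () from rfl, h]
  rfl

/-- The ZERO instance generator `gen₀ s = 0^{|s|}` (the instance reveals only the seed length). [folklore] -/
def zerosGen : List Bool → List Bool := zerosT'.eval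

/-- `gen₀ s = 0^{|s|}`. [folklore] -/
theorem zerosGen_apply (s : List Bool) : zerosGen s = List.replicate s.length false := zerosT'_eval s

/-- `gen₀ ∈ FP` (a finite-state transduction; tree: `FST.polyTimeComputable_eval`). [folklore] -/
theorem zerosGen_polyTime : PolyTimeComputable id id zerosGen := zerosT'.polyTimeComputable_eval

/-- `gen₀` preserves lengths. [folklore] -/
theorem length_zerosGen (s : List Bool) : (zerosGen s).length = s.length := by
  rw [zerosGen_apply, List.length_replicate]

/-- Every symbol of `gen₀ s` is `0`. [folklore] -/
theorem get_zerosGen (s : List Bool) (i : Fin (zerosGen s).length) : (zerosGen s).get i = false := by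
  have hall : ∀ b ∈ zerosGen s, b = false := fun b hb => by
    rw [zerosGen_apply] at hb
    exact List.eq_of_mem_replicate hb
  exact hall _ (List.get_mem _ _)

/-- **`NOT` gates on distinct wires flip exactly those wires.** [folklore] -/
theorem revEval_map_not {N : ℕ} (l : List (Fin N)) (hl : l.Nodup) (w : QReg N) :
    revEval (l.map RevOp.not) w = fun j => w j ^^ decide (j ∈ l) := by
  induction l generalizing w with
  | nil => funext j; simp [revEval]
  | cons i l ih =>
    have hi : i ∉ l := (List.nodup_cons.1 hl).1
    rw [List.map_cons, show revEval (RevOp.not i :: l.map RevOp.not) w =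
      revEval (l.map RevOp.not) ((RevOp.not i).eval w) from rfl, ih (List.nodup_cons.1 hl).2]
    funext j
    by_cases hji : j = i
    · subst hji
      simp [RevOp.eval, hi]
    · simp [RevOp.eval, hji]

/-- The input wires to flip for the hard-wired answer `a ∈ {0,1}ⁿ` (no ancillas: wires `Fin (n + 0)`). [folklore] -/
def flipWires {n : ℕ} (a : List.Vector Bool n) : List (Fin (n + 0)) :=
  ((List.finRange n).filter fun i => a.get i).map (Fin.castAdd 0)

/-- The flipped wires are distinct. [folklore] -/
theorem flipWires_nodup {n : ℕ} (a : List.Vector Bool n) : (flipWires a).Nodup :=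
  ((List.nodup_finRange n).filter _).map (Fin.castAdd_injective _ _)

/-- Input wire `i` is flipped iff `aᵢ = 1`. [folklore] -/
theorem mem_flipWires {n : ℕ} (a : List.Vector Bool n) (i : Fin n) :
    Fin.castAdd 0 i ∈ flipWires a ↔ a.get i = true := by
  unfold flipWires
  rw [List.mem_map_of_injective (Fin.castAdd_injective _ _)]
  simp

/-- The NON-UNIFORM hard-wired family: on `n` input wires (no ancillas) flip the wires where the
length-`n` answer `a n` is `1`; compiled `X = H S S H` words, Clifford only, oracle-free.
[cite: NielsenChuang2010, Ex. 4.18] -/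
noncomputable def hardwiredFamily (a : (n : ℕ) → List.Vector Bool n) : QCircuitFamily cliffordT where
  ancillas _ := 0
  circ n := ⟨revCompile ((flipWires (a n)).map RevOp.not)⟩

/-- The hard-wired family is oracle-free (compiled gate words). [folklore] -/
theorem hardwiredFamily_isOracleFree (a : (n : ℕ) → List.Vector Bool n) :
    (hardwiredFamily a).IsOracleFree := fun _ => revCompile_isOracleFree _

/-- **A family whose circuit maps the padded input basis state to a basis state `|z⟩` outputs the
string `z` with probability one.** [cite: NielsenChuang2010, §2.2.5] -/
theorem kernelProb_eq_one_of_runOn_basisState {G : QGateSet} (F : QCircuitFamily G) (x : List Bool)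
    {z : QReg (x.length + F.ancillas x.length)}
    (hrun : (F.circ x.length).runOn 0 (basisState (padInput x.get (F.ancillas x.length))) = basisState z)
    {E : Set (List Bool)} (hE : List.ofFn z ∈ E) : F.kernelProb 0 x E = 1 := by
  unfold QCircuitFamily.kernelProb QCircuitFamily.kernel QCircuit.outputPMF
  rw [hrun, PMF.toOuterMeasure_map_apply]
  have hsum : ∑ i, ‖basisState z i‖ ^ 2 = 1 := normSq_basisState z
  have h1 : (bornPMF (basisState z)).toOuterMeasure (List.ofFn ⁻¹' E) = 1 := by
    rw [PMF.toOuterMeasure_apply_eq_one_iff]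
    intro i hi
    rw [PMF.mem_support_iff, bornPMF_apply_of_sum_eq_one hsum] at hi
    have hiz : i = z := by
      by_contra hne
      exact hi (by simp [basisState_apply, hne])
    subst hiz
    exact hE
  rw [h1, ENNReal.toReal_one]

/-- On an all-zero input of length `n` the hard-wired family outputs exactly `a n`. [folklore] -/
theorem hardwiredFamily_kernelProb (a : (n : ℕ) → List.Vector Bool n) (x : List Bool)
    (hx : ∀ i, x.get i = false) :
    (hardwiredFamily a).kernelProb 0 x {y | (a x.length).toList <+: y} = 1 := by
  -- the measured string after the flips IS `a |x|` (no ancillas)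
  have hE : List.ofFn (revEval ((flipWires (a x.length)).map RevOp.not) (padInput x.get 0)) ∈
      {y : List Bool | (a x.length).toList <+: y} := by
    rw [revEval_map_not _ (flipWires_nodup (a x.length)), Set.mem_setOf_eq, List.ofFn_add]
    have hpad : ∀ i : Fin x.length, padInput x.get 0 (Fin.castAdd 0 i) = false := fun i => by
      rw [padInput, Fin.append_left]; exact hx i
    have hval : (fun i : Fin x.length => (padInput x.get 0 (Fin.castAdd 0 i) ^^
        decide (Fin.castAdd 0 i ∈ flipWires (a x.length)))) = (a x.length).get := by
      funext i
      rw [hpad, Bool.false_xor]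
      by_cases h : (a x.length).get i = true
      · rw [h, decide_eq_true ((mem_flipWires (a x.length) i).2 h)]
      · rw [Bool.not_eq_true] at h
        rw [h, decide_eq_false (fun hm => by
          rw [(mem_flipWires (a x.length) i).1 hm] at h; exact Bool.noConfusion h)]
    have h0 : (List.ofFn fun i : Fin x.length => (padInput x.get 0 (Fin.castAdd 0 i) ^^
        decide (Fin.castAdd 0 i ∈ flipWires (a x.length)))) = (a x.length).toList := by
      rw [hval, ← List.Vector.toList_ofFn, List.Vector.ofFn_get]
    -- `List.ofFn_add` states the first block with `Fin.castLE`; `Fin.castAdd 0 = Fin.castLE _` by `rfl`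
    have h0' : (List.ofFn fun i : Fin x.length =>
        (padInput x.get 0 (Fin.castLE (Nat.le_add_right x.length 0) i) ^^
          decide (Fin.castLE (Nat.le_add_right x.length 0) i ∈ flipWires (a x.length)))) =
        (a x.length).toList := h0
    rw [h0']
    exact List.prefix_append _ _
  exact kernelProb_eq_one_of_runOn_basisState (hardwiredFamily a) x
    (revCompile_mulVec_basisState 0 _ _) hE

/-- **X with `F.IsUniform` DROPPED is a theorem.** With the zero generator `gen₀ s = 0^{|s|}` (FP), the
diagonal answers `ans s = bad gen₀ |s|` of §7 (classically hard on average for every PPT,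
`clauseC_diagAns`), and the NON-UNIFORM hard-wired Clifford family writing `bad gen₀ n` on the `n` zeroed
input wires (probability 1, `hardwiredFamily_kernelProb`): every conjunct of X except uniformity holds.
So the single UNIFORM family is as load-bearing as (Q) itself: X is a statement about uniform quantum
computation versus uniform classical computation, and nothing less. [folklore] -/
theorem wbwThesis_without_uniform_holds :
    ∃ (gen ans : List Bool → List Bool), PolyTimeComputable id id gen ∧
      (∃ p : Polynomial ℕ, ∀ s, (ans s).length = p.eval (gen s).length) ∧
      (∃ F : QCircuitFamily cliffordT, F.IsOracleFree ∧
        ∀ s, 2 / 3 ≤ F.kernelProb 0 (gen s) {y | ans s <+: y}) ∧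
      ClauseC gen ans := by
  refine ⟨zerosGen, diagAns zerosGen, zerosGen_polyTime, ⟨Polynomial.X, fun s => ?_⟩,
    ⟨hardwiredFamily (bad zerosGen), hardwiredFamily_isOracleFree _, fun s => ?_⟩,
    clauseC_diagAns length_zerosGen⟩
  · simp [diagAns, length_zerosGen]
  · have h := hardwiredFamily_kernelProb (bad zerosGen) (zerosGen s) (get_zerosGen s)
    have hbad : ∀ m, m = s.length → (bad zerosGen m).toList = (bad zerosGen s.length).toList := by
      rintro m rfl; rfl
    rw [hbad _ (length_zerosGen s)] at h
    simp only [diagAns]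
    rw [h]
    norm_num

/-- Clause (Q) WITHOUT uniformity for a fixed pair `(gen, ans)`: SOME oracle-free Clifford+T family
(poly-size or not, uniform or not) outputs `ans s` with probability `≥ 2/3` on input `gen s`, every `s`.
[folklore] -/
def ClauseQNonUniform (gen ans : List Bool → List Bool) : Prop :=
  ∃ F : QCircuitFamily cliffordT, F.IsOracleFree ∧ ∀ s, 2 / 3 ≤ F.kernelProb 0 (gen s) {y | ans s <+: y}

/-- The hard-wired family witnesses the non-uniform quantum clause for `(gen₀, diagAns gen₀)`, with
probability one. [folklore] -/
theorem clauseQNonUniform_zerosGen : ClauseQNonUniform zerosGen (diagAns zerosGen) := by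
  refine ⟨hardwiredFamily (bad zerosGen), hardwiredFamily_isOracleFree _, fun s => ?_⟩
  have h := hardwiredFamily_kernelProb (bad zerosGen) (zerosGen s) (get_zerosGen s)
  have hbad : ∀ m, m = s.length → (bad zerosGen m).toList = (bad zerosGen s.length).toList := by
    rintro m rfl; rfl
  rw [hbad _ (length_zerosGen s)] at h
  simp only [diagAns]
  rw [h]
  norm_num

/-- Conjunction form of `wbwThesis_without_uniform_holds` for the explicit pair (the shape filed under
`Negative/NonUniform.lean`). [folklore] -/
theorem wbwThesis_without_uniform_holds' :
    PolyTimeComputable id id zerosGen ∧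
      (∀ s, (diagAns zerosGen s).length = (Polynomial.X : Polynomial ℕ).eval (zerosGen s).length) ∧
      ClauseQNonUniform zerosGen (diagAns zerosGen) ∧ ClauseC zerosGen (diagAns zerosGen) :=
  ⟨zerosGen_polyTime, fun s => by simp [diagAns, length_zerosGen], clauseQNonUniform_zerosGen,
    clauseC_diagAns length_zerosGen⟩

end NonUniform


end Summit.QuantumAdvantage.QuantumAdvantage.Cruxes.WbwThesis.Disproof
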